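import Summits.NavierStokesRegularity.NavierStokesRegularity.Theses.AngularGalerkinLadder
import Literature.Analysis.FluidPDE.ClassicalSolutionGlue
import Literature.Analysis.FluidPDE.MildSolutionProofs

/-!
# Route `AngularGalerkinLadder` · K3b `StructurePasses` under SPACE–TIME local uniform convergence

Cell `ns-blowup`, seat `ns-blowup-lean` (g11); `--supports stmt-NavierStokesRegularity-19855`.
LABEL: KERNEL support (sorry-free). WHAT THIS IS NOT: not Navier–Stokes evidence — bookkeeping that
passes the rotated-DSS structure, the Type-I bound, nontriviality, measurability and the ancient
mild formulation to a GIVEN ladder limit; no window sequence is constructed, no crux is closed.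

## Content

Item 19855 `StructurePasses` (route rev 4) reads the ladder limit of the K3 split with the
FIXED-SLICE convergence clause (4) `∀ t < 0, TendstoLocallyUniformly (fun n => u (φ n) t) (v t)`.
The rotated-DSS identity `c • R.symm (u (c² t) (c • R x)) = u t x` evaluates `u (φ n)` at the
MOVING times `c (φ n)² t`, so its passage to the limit needs convergence in space AND time. This
file proves the item's conclusion VERBATIM from the same hypotheses with clause (4) replaced by

  (4′) `TendstoLocallyUniformlyOn (fun n => uncurry (u (φ n))) (uncurry v) atTop (Iio 0 ×ˢ univ)`

(`angularGalerkinLadder_structurePasses_spaceTime`), and records that (4′) implies (4)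
(`tendstoLocallyUniformly_slice_of_spaceTime`), so that the correspondingly restated
`LocalCompactness` implies the rev-4 one (`angularGalerkinLadder_localCompactness_of_spaceTime`).
Ingredients: `tendsto_linearIsometryEquiv_symm` (`R_n → R'` pointwise ⇒ `R_n⁻¹ w_n → R'⁻¹ w`),
`isRotatedDSS_of_spaceTimeLimit` (Mathlib `TendstoLocallyUniformlyOn.tendsto_comp` at the moving
points `(c_n² t, c_n R_n x)`; the cutoff clause handles `t ≥ 0`), `not_ae_zero_of_floor` (the
amplitude floor `δ ≤ ‖u_n(−1, x_n)‖` lives in the ball `‖x‖ ≤ C₀/δ − 1` by the Type-I weight and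
survives uniform convergence on `{−1} × ball`), `isBoundedOn_Iic_of_hasTypeIDecay'` (Type-I ⇒ bounded on past slabs) feeding
`isAncientMildSolution_of_classical_Iio'` (Fabes–Jones–Rivière on past slabs; private copies of the
route-CorkscrewDynamo tree theorems, to stay outside that route's cone).

References: [cite: ChaeWolf2017, Def. 1.1] (rotated DSS); [cite: KNSS2009, (1.6)] (Type-I decay).
-/

set_option linter.dupNamespace false

namespace Summit.NavierStokesRegularity.NavierStokesRegularity.Theorems

open Set Filter MeasureTheory Topology Function
open Literature.Analysis.FluidPDE
open Summit.NavierStokesRegularity.FluidComputer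

/-! ## §1 Limits of rotations and of rotated-DSS identities -/

/-- If linear isometries converge pointwise, `R_n x → R' x`, then so do their inverses along any
convergent sequence: `w_n → w ⇒ R_n⁻¹ w_n → R'⁻¹ w` (`‖R_n⁻¹ w − R'⁻¹ w‖ = ‖w − R_n R'⁻¹ w‖`).
[folklore] -/
theorem tendsto_linearIsometryEquiv_symm {E : Type*} [NormedAddCommGroup E] [InnerProductSpace ℝ E]
    {R : ℕ → E ≃ₗᵢ[ℝ] E} {R' : E ≃ₗᵢ[ℝ] E} (hR : ∀ x, Tendsto (fun n => R n x) atTop (𝓝 (R' x)))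
    {w : ℕ → E} {w' : E} (hw : Tendsto w atTop (𝓝 w')) :
    Tendsto (fun n => (R n).symm (w n)) atTop (𝓝 (R'.symm w')) := by
  have h1 : Tendsto (fun n => (R n).symm (w n - w')) atTop (𝓝 0) := by
    rw [tendsto_zero_iff_norm_tendsto_zero]
    have e : (fun n => ‖(R n).symm (w n - w')‖) = fun n => ‖w n - w'‖ :=
      funext fun n => LinearIsometryEquiv.norm_map _ _
    rw [e, ← tendsto_zero_iff_norm_tendsto_zero]
    exact tendsto_sub_nhds_zero_iff.2 hw
  have h2 : Tendsto (fun n => (R n).symm w' - R'.symm w') atTop (𝓝 0) := by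
    rw [tendsto_zero_iff_norm_tendsto_zero]
    have e : (fun n => ‖(R n).symm w' - R'.symm w'‖) = fun n => ‖w' - R n (R'.symm w')‖ :=
      funext fun n => by
        rw [← (R n).norm_map ((R n).symm w' - R'.symm w'), map_sub, LinearIsometryEquiv.apply_symm_apply]
    rw [e]
    have h3 : Tendsto (fun n => w' - R n (R'.symm w')) atTop (𝓝 (w' - R' (R'.symm w'))) :=
      tendsto_const_nhds.sub (hR _)
    rw [LinearIsometryEquiv.apply_symm_apply, sub_self] at h3
    exact tendsto_zero_iff_norm_tendsto_zero.1 h3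
  have e : (fun n => (R n).symm (w n)) =
      fun n => (R n).symm (w n - w') + ((R n).symm w' - R'.symm w') + R'.symm w' := by
    funext n
    simp only [map_sub, sub_add_sub_cancel, sub_add_cancel]
  rw [e]
  simpa using (h1.add h2).add (tendsto_const_nhds (x := R'.symm w'))

/-- **The rotated-DSS structure passes to space–time locally uniform limits.** If every `u_n` is
rotated DSS with factor `c_n > 0` and rotation `R_n`, `c_n → c' > 0`, `R_n → R'` pointwise,
`u_n → v` locally uniformly on the open past `(−∞, 0) × ℝ³` with `v` continuous there, and `v`
vanishes on `t ≥ 0`, then `v` is rotated DSS with `(c', R')`. [cite: ChaeWolf2017, Def. 1.1] -/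
theorem isRotatedDSS_of_spaceTimeLimit
    {u : ℕ → ℝ → EuclideanSpace ℝ (Fin 3) → EuclideanSpace ℝ (Fin 3)} {c : ℕ → ℝ}
    {R : ℕ → EuclideanSpace ℝ (Fin 3) ≃ₗᵢ[ℝ] EuclideanSpace ℝ (Fin 3)}
    {v : ℝ → EuclideanSpace ℝ (Fin 3) → EuclideanSpace ℝ (Fin 3)} {c' : ℝ}
    {R' : EuclideanSpace ℝ (Fin 3) ≃ₗᵢ[ℝ] EuclideanSpace ℝ (Fin 3)}
    (hdss : ∀ n, IsRotatedDSS (c n) (R n) (u n)) (hcpos : ∀ n, 0 < c n)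
    (hc : Tendsto c atTop (𝓝 c')) (hc' : 0 < c')
    (hR : ∀ x, Tendsto (fun n => R n x) atTop (𝓝 (R' x)))
    (hconv : TendstoLocallyUniformlyOn (fun n => uncurry (u n)) (uncurry v) atTop (Iio 0 ×ˢ univ))
    (hvc : ContinuousOn (uncurry v) (Iio 0 ×ˢ univ)) (hcut : ∀ t, 0 ≤ t → v t = 0) :
    IsRotatedDSS c' R' v := by
  intro t x
  by_cases ht : t < 0
  · -- the moving points `(c_n² t, c_n R_n x) → (c'² t, c' R' x)` stay in the open past
    have hP : (c' ^ 2 * t, c' • R' x) ∈ Iio (0 : ℝ) ×ˢ (univ : Set (EuclideanSpace ℝ (Fin 3))) :=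
      ⟨mul_neg_of_pos_of_neg (pow_pos hc' 2) ht, mem_univ _⟩
    have hgmem : ∀ n, (c n ^ 2 * t, c n • R n x) ∈
        Iio (0 : ℝ) ×ˢ (univ : Set (EuclideanSpace ℝ (Fin 3))) := fun n =>
      ⟨mul_neg_of_pos_of_neg (pow_pos (hcpos n) 2) ht, mem_univ _⟩
    have hg : Tendsto (fun n => (c n ^ 2 * t, c n • R n x)) atTop (𝓝 (c' ^ 2 * t, c' • R' x)) :=
      ((hc.pow 2).mul_const t).prodMk_nhds (hc.smul (hR x))
    have hgw : Tendsto (fun n => (c n ^ 2 * t, c n • R n x)) atTop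
        (𝓝[Iio (0 : ℝ) ×ˢ (univ : Set (EuclideanSpace ℝ (Fin 3)))] (c' ^ 2 * t, c' • R' x)) :=
      tendsto_nhdsWithin_iff.2 ⟨hg, Eventually.of_forall hgmem⟩
    have hlim1 : Tendsto (fun n => u n (c n ^ 2 * t) (c n • R n x)) atTop
        (𝓝 (v (c' ^ 2 * t) (c' • R' x))) :=
      hconv.tendsto_comp (hvc _ hP) hP hgw
    have hlim2 : Tendsto (fun n => c n • (R n).symm (u n (c n ^ 2 * t) (c n • R n x))) atTop
        (𝓝 (c' • R'.symm (v (c' ^ 2 * t) (c' • R' x)))) :=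
      hc.smul (tendsto_linearIsometryEquiv_symm hR hlim1)
    have e : (fun n => c n • (R n).symm (u n (c n ^ 2 * t) (c n • R n x))) = fun n => u n t x :=
      funext fun n => hdss n t x
    rw [e] at hlim2
    have hlim3 : Tendsto (fun n => u n t x) atTop (𝓝 (v t x)) :=
      hconv.tendsto_at (a := (t, x)) ⟨ht, mem_univ _⟩
    exact tendsto_nhds_unique hlim2 hlim3
  · have ht0 : 0 ≤ t := not_lt.1 ht
    have h1 : v t = 0 := hcut t ht0
    have h2 : v (c' ^ 2 * t) = 0 := hcut _ (mul_nonneg (sq_nonneg _) ht0)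
    rw [h1, h2]
    simp

/-- Space–time locally uniform convergence on the open past implies locally uniform convergence
of every past slice (clause (4′) ⇒ clause (4)). [folklore] -/
theorem tendstoLocallyUniformly_slice_of_spaceTime
    {u : ℕ → ℝ → EuclideanSpace ℝ (Fin 3) → EuclideanSpace ℝ (Fin 3)}
    {v : ℝ → EuclideanSpace ℝ (Fin 3) → EuclideanSpace ℝ (Fin 3)}
    (hconv : TendstoLocallyUniformlyOn (fun n => uncurry (u n)) (uncurry v) atTop (Iio 0 ×ˢ univ))
    {t : ℝ} (ht : t < 0) : TendstoLocallyUniformly (fun n => u n t) (v t) atTop := by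
  rw [tendstoLocallyUniformly_iff_forall_isCompact]
  intro K hK
  have hsub : ({t} : Set ℝ) ×ˢ K ⊆ Iio (0 : ℝ) ×ˢ (univ : Set (EuclideanSpace ℝ (Fin 3))) :=
    prod_mono (singleton_subset_iff.2 ht) (subset_univ _)
  have hKc : IsCompact (({t} : Set ℝ) ×ˢ K) := isCompact_singleton.prod hK
  have hU := ((tendstoLocallyUniformlyOn_iff_forall_isCompact (isOpen_Iio.prod isOpen_univ)).1
    hconv _ hsub hKc).comp (fun y : EuclideanSpace ℝ (Fin 3) => (t, y))
  exact hU.mono fun y hy => ⟨rfl, hy⟩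

/-! ## §2 Nontriviality and past-slab bounds from the Type-I weight -/

/-- **The amplitude floor survives.** If every `u_n` is Type-I with constant `C₀` and has a point
`x_n` with `δ ≤ ‖u_n(−1, x_n)‖`, `δ > 0`, and `u_n → v` locally uniformly on the open past with
`v(−1, ·)` continuous, then `v` is not a.e. zero on every past slice: the floor points live in
the ball `‖x‖ ≤ C₀/δ − 1`, on which `u_n(−1, ·) → v(−1, ·)` uniformly. [cite: KNSS2009, (1.6)] -/
theorem not_ae_zero_of_floor
    {u : ℕ → ℝ → EuclideanSpace ℝ (Fin 3) → EuclideanSpace ℝ (Fin 3)}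
    {v : ℝ → EuclideanSpace ℝ (Fin 3) → EuclideanSpace ℝ (Fin 3)} {C₀ δ : ℝ} (hδ : 0 < δ)
    (hTI : ∀ n, HasTypeIDecay C₀ (u n)) (hfloor : ∀ n, ∃ x, δ ≤ ‖u n (-1) x‖)
    (hconv : TendstoLocallyUniformlyOn (fun n => uncurry (u n)) (uncurry v) atTop (Iio 0 ×ˢ univ))
    (hvc : Continuous (v (-1))) :
    ¬ (∀ t < 0, v t =ᵐ[volume] 0) := by
  intro H
  have h0 : v (-1) = 0 := (hvc.ae_eq_iff_eq volume continuous_const).1 (H (-1) (by norm_num))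
  choose xs hxs using hfloor
  -- the floor points are confined to the ball of radius `C₀/δ − 1`
  have hxρ : ∀ n, ‖xs n‖ ≤ C₀ / δ - 1 := fun n => by
    have h1 := hTI n (-1) (by norm_num) (xs n)
    rw [neg_neg, Real.sqrt_one] at h1
    have hpos : 0 < ‖xs n‖ + 1 := by positivity
    have h2 : δ * (‖xs n‖ + 1) ≤ C₀ := (le_div_iff₀ hpos).1 ((hxs n).trans h1)
    rw [le_sub_iff_add_le, le_div_iff₀ hδ]
    linarith
  -- uniform convergence on the compact set `{−1} × closedBall 0 (C₀/δ − 1)`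
  have hKs : ({-1} : Set ℝ) ×ˢ Metric.closedBall (0 : EuclideanSpace ℝ (Fin 3)) (C₀ / δ - 1) ⊆
      Iio (0 : ℝ) ×ˢ (univ : Set (EuclideanSpace ℝ (Fin 3))) :=
    prod_mono (singleton_subset_iff.2 (by norm_num)) (subset_univ _)
  have hK : IsCompact (({-1} : Set ℝ) ×ˢ
      Metric.closedBall (0 : EuclideanSpace ℝ (Fin 3)) (C₀ / δ - 1)) :=
    isCompact_singleton.prod (isCompact_closedBall _ _)
  have hU := (tendstoLocallyUniformlyOn_iff_forall_isCompact (isOpen_Iio.prod isOpen_univ)).1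
    hconv _ hKs hK
  rw [Metric.tendstoUniformlyOn_iff] at hU
  obtain ⟨n, hn⟩ := (hU (δ / 2) (half_pos hδ)).exists
  have hmem : ((-1 : ℝ), xs n) ∈ ({-1} : Set ℝ) ×ˢ
      Metric.closedBall (0 : EuclideanSpace ℝ (Fin 3)) (C₀ / δ - 1) :=
    ⟨rfl, mem_closedBall_zero_iff.2 (hxρ n)⟩
  have hd := hn ((-1 : ℝ), xs n) hmem
  simp only [Function.uncurry_apply_pair, h0, Pi.zero_apply, dist_comm (0 : EuclideanSpace ℝ (Fin 3)),
    dist_zero_right] at hd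
  linarith [hxs n]

/-! ## §2b Ancient mild from classical (private copies of route-independent tree facts) -/

/-- Classical solutions on the past with `u`, `p` bounded on past slabs are ancient mild solutions
(Fabes–Jones–Rivière via the tree's `IsClassicalNSSolutionOn.isMildNSSolutionOn_holds`). Private
copy of `Theorems.isAncientMildSolution_of_classical_Iio` (route-CorkscrewDynamo file), kept here
to avoid importing a module in another route's cone. [folklore] -/
private theorem isAncientMildSolution_of_classical_Iio' {E : Type*} [NormedAddCommGroup E]
    [InnerProductSpace ℝ E] [FiniteDimensional ℝ E] [MeasurableSpace E] [BorelSpace E]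
    {ν : ℝ} (hν : 0 < ν) {u : ℝ → E → E} {p : ℝ → E → ℝ}
    (hcl : IsClassicalNSSolutionOn (Iio 0) ν 0 u p)
    (hu : ∀ t < 0, IsBoundedOn (Iic t) u) (hp : ∀ t < 0, IsBoundedOn (Iic t) p) :
    IsAncientMildSolution ν u := by
  refine ⟨fun t ht => ?_, fun s t hst ht => ?_⟩
  · exact VectorCalculus.IsDivFree.isWeaklyDivFree_holds (hcl.divFree t ht)
      (contDiff_infty.1 (hcl.contDiff_velocity ht) 1)
  · -- the time-translate by `s` is classical on `(· + s)⁻¹' (-∞, 0) ⊇ [0, t - s]`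
    have hE : IsClassicalNSSolutionOn ((· + s) ⁻¹' Iio 0) ν (fun τ => (0 : ℝ → E → E) (τ + s))
        (fun τ => u (τ + s)) (fun τ => p (τ + s)) := hcl.comp_add_right s
    have hshift : ∀ {τ : ℝ}, τ ∈ Icc 0 (t - s) → τ + s ≤ t := fun hτ => by linarith [hτ.2]
    have hIcc : Icc 0 (t - s) ⊆ (· + s) ⁻¹' Iio (0 : ℝ) := fun τ hτ => by
      show τ + s < 0
      linarith [hshift hτ]
    obtain ⟨Mu, hMu⟩ := hu t ht
    obtain ⟨Mp, hMp⟩ := hp t ht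
    have hbu : IsBoundedOn (Icc 0 (t - s)) (fun τ => u (τ + s)) :=
      ⟨Mu, fun τ hτ x => hMu (τ + s) (hshift hτ) x⟩
    have hbp : IsBoundedOn (Icc 0 (t - s)) (fun τ => p (τ + s)) :=
      ⟨Mp, fun τ hτ x => hMp (τ + s) (hshift hτ) x⟩
    have hbf : IsBoundedOn (Icc 0 (t - s)) (fun τ => (0 : ℝ → E → E) (τ + s)) :=
      ⟨0, fun τ _ x => by simp⟩
    -- Fabes–Jones–Rivière on `[0, t - s]`
    have hmild : IsMildNSSolutionOn (Icc 0 (t - s)) ν (fun τ => (0 : ℝ → E → E) (τ + s))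
        ((fun τ => u (τ + s)) 0) (fun τ => u (τ + s)) :=
      IsClassicalNSSolutionOn.isMildNSSolutionOn_holds (T := t - s) hE hν hIcc hbu hbp hbf
    have key : IsMildNSSolutionBetween ν (fun τ => (0 : ℝ → E → E) (τ + s)) (fun τ => u (τ + s))
        (s + -s) (t + -s) := by
      rw [add_neg_cancel, ← sub_eq_add_neg]
      exact isMildNSSolutionFrom_self_iff.1 (hmild.2 (t - s) ⟨by linarith, le_rfl⟩)
    -- translate back by `-s`
    have h3 := key.comp_add_right
    have hu_eq : (fun τ => u (τ + -s + s)) = u := funext fun τ => by rw [neg_add_cancel_right]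
    have hf_eq : (fun τ => (0 : ℝ → E → E) (τ + -s + s)) = 0 := funext fun τ => by simp
    rwa [hu_eq, hf_eq] at h3

/-- A Type-I bounded field is bounded on every past slab `(-∞, t]`, `t < 0` (private copy of
`Theorems.isBoundedOn_Iic_of_hasTypeIDecay`). [cite: KNSS2009, (1.6)] -/
private theorem isBoundedOn_Iic_of_hasTypeIDecay' {E F : Type*} [NormedAddCommGroup E]
    [NormedAddCommGroup F] {C₀ : ℝ} {u : ℝ → E → F} (h : HasTypeIDecay C₀ u) {t : ℝ}
    (ht : t < 0) : IsBoundedOn (Iic t) u := by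
  have hC₀ : 0 ≤ C₀ := by
    have h1 := (norm_nonneg _).trans (h (-1) (by norm_num) 0)
    simpa using h1
  exact ((h.hasTypeITimeDecay hC₀).isBoundedOn hC₀ (by linarith : 0 < -t / 2)).mono
    fun t' ht' => by
      simp only [mem_Iic, mem_Iio] at ht' ⊢
      linarith

/-! ## §3 `StructurePasses` under clause (4′) -/

/-- **K3b under space–time convergence.** The conclusion of item 19855 `StructurePasses` —
`1 < c'`, ancient mild, slice-measurable, rotated DSS with `(c', R')`, Type-I, not a.e. zero —
for every window sequence and every ladder limit whose convergence clause is the SPACE–TIME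
locally uniform convergence (4′) on `(−∞, 0) × ℝ³` (the other seven clauses verbatim as in the
route file, rev 4). [cite: ChaeWolf2017, Def. 1.1] -/
theorem angularGalerkinLadder_structurePasses_spaceTime :
    ∀ (C₀ cmin cmax δ : ℝ) (L : ℕ → ℕ) (ε c : ℕ → ℝ)
      (R : ℕ → (EuclideanSpace ℝ (Fin 3) ≃ₗᵢ[ℝ] EuclideanSpace ℝ (Fin 3)))
      (u : ℕ → ℝ → EuclideanSpace ℝ (Fin 3) → EuclideanSpace ℝ (Fin 3))
      (p : ℕ → ℝ → EuclideanSpace ℝ (Fin 3) → ℝ)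
      (d : ℕ → ℝ → EuclideanSpace ℝ (Fin 3) → EuclideanSpace ℝ (Fin 3)) (φ : ℕ → ℕ) (c' : ℝ)
      (R' : EuclideanSpace ℝ (Fin 3) ≃ₗᵢ[ℝ] EuclideanSpace ℝ (Fin 3))
      (v : ℝ → EuclideanSpace ℝ (Fin 3) → EuclideanSpace ℝ (Fin 3))
      (q : ℝ → EuclideanSpace ℝ (Fin 3) → ℝ),
      (1 < cmin ∧ 0 < δ ∧ Tendsto ε atTop (𝓝 0) ∧
        ∀ n, AngularLadder.IsWindowProfile (L n) C₀ cmin cmax δ (ε n) (c n) (R n) (u n) (p n) (d n)) →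
      (StrictMono φ ∧ Tendsto (fun n => c (φ n)) atTop (𝓝 c') ∧
        (∀ x, Tendsto (fun n => R (φ n) x) atTop (𝓝 (R' x))) ∧
        TendstoLocallyUniformlyOn (fun n => Function.uncurry (u (φ n))) (Function.uncurry v) atTop
          (Set.Iio 0 ×ˢ Set.univ) ∧
        IsClassicalNSSolutionOn (Set.Iio 0) 1 0 v q ∧ HasTypeIDecay C₀ v ∧
        (∀ t, 0 ≤ t → v t = 0) ∧ ∀ t < 0, IsBoundedOn (Set.Iic t) q) →
      1 < c' ∧ IsAncientMildSolution 1 v ∧ (∀ t < 0, AEStronglyMeasurable (v t) volume) ∧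
        IsRotatedDSS c' R' v ∧ (∃ C : ℝ, HasTypeIDecay C v) ∧ ¬ (∀ t < 0, v t =ᵐ[volume] 0) := by
  intro C₀ cmin cmax δ L ε c R u p d φ c' R' v q hseq hlim
  obtain ⟨hcmin, hδ, -, hW⟩ := hseq
  obtain ⟨-, hc, hR, hconv, hcl, hTI, hcut, hq⟩ := hlim
  have hcn : ∀ n, cmin ≤ c (φ n) := fun n => (hW (φ n)).2.1
  have hc' : cmin ≤ c' := ge_of_tendsto hc (Eventually.of_forall hcn)
  have h1c' : 1 < c' := lt_of_lt_of_le hcmin hc'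
  have hvc : ContinuousOn (uncurry v) (Iio 0 ×ˢ univ) := hcl.smooth_velocity.continuousOn
  refine ⟨h1c', ?_, ?_, ?_, ⟨C₀, hTI⟩, ?_⟩
  · exact isAncientMildSolution_of_classical_Iio' one_pos hcl
      (fun t ht => isBoundedOn_Iic_of_hasTypeIDecay' hTI ht) hq
  · intro t ht
    exact (hcl.smooth_velocity.contDiff_slice ht).continuous.aestronglyMeasurable
  · exact isRotatedDSS_of_spaceTimeLimit (fun n => (hW (φ n)).1.isRotatedDSS)
      (fun n => lt_of_lt_of_le (zero_lt_one.trans hcmin) (hcn n)) hc (zero_lt_one.trans h1c') hR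
      hconv hvc hcut
  · exact not_ae_zero_of_floor hδ (fun n => (hW (φ n)).1.hasTypeIDecay)
      (fun n => (hW (φ n)).2.2.2.1) hconv
      (hcl.smooth_velocity.contDiff_slice (show (-1 : ℝ) ∈ Iio 0 by norm_num)).continuous

/-- **The restated `LocalCompactness` (clause (4′)) implies the rev-4 one (clause (4)).** So the
restatement strengthens K3a and keeps the glue `LocalCompactness → StructurePasses →
LimitTransfer` meaningful with either reading of K3b. [folklore] -/
theorem angularGalerkinLadder_localCompactness_of_spaceTime
    (h : ∀ (C₀ cmin cmax δ : ℝ) (L : ℕ → ℕ) (ε c : ℕ → ℝ)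
      (R : ℕ → (EuclideanSpace ℝ (Fin 3) ≃ₗᵢ[ℝ] EuclideanSpace ℝ (Fin 3)))
      (u : ℕ → ℝ → EuclideanSpace ℝ (Fin 3) → EuclideanSpace ℝ (Fin 3))
      (p : ℕ → ℝ → EuclideanSpace ℝ (Fin 3) → ℝ)
      (d : ℕ → ℝ → EuclideanSpace ℝ (Fin 3) → EuclideanSpace ℝ (Fin 3)),
      (1 < cmin ∧ 0 < δ ∧ Tendsto ε atTop (𝓝 0) ∧
        ∀ n, AngularLadder.IsWindowProfile (L n) C₀ cmin cmax δ (ε n) (c n) (R n) (u n) (p n) (d n)) →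
      ∃ (φ : ℕ → ℕ) (c' : ℝ) (R' : EuclideanSpace ℝ (Fin 3) ≃ₗᵢ[ℝ] EuclideanSpace ℝ (Fin 3))
        (v : ℝ → EuclideanSpace ℝ (Fin 3) → EuclideanSpace ℝ (Fin 3))
        (q : ℝ → EuclideanSpace ℝ (Fin 3) → ℝ),
        StrictMono φ ∧ Tendsto (fun n => c (φ n)) atTop (𝓝 c') ∧
          (∀ x, Tendsto (fun n => R (φ n) x) atTop (𝓝 (R' x))) ∧
          TendstoLocallyUniformlyOn (fun n => Function.uncurry (u (φ n))) (Function.uncurry v) atTop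
            (Set.Iio 0 ×ˢ Set.univ) ∧
          IsClassicalNSSolutionOn (Set.Iio 0) 1 0 v q ∧ HasTypeIDecay C₀ v ∧
          (∀ t, 0 ≤ t → v t = 0) ∧ ∀ t < 0, IsBoundedOn (Set.Iic t) q) :
    Summit.NavierStokesRegularity.NavierStokesRegularity.Theses.AngularGalerkinLadder.LocalCompactness := by
  intro C₀ cmin cmax δ L ε c R u p d hseq
  obtain ⟨φ, c', R', v, q, hφ, hc, hR, hconv, hcl, hTI, hcut, hq⟩ := h C₀ cmin cmax δ L ε c R u p d hseq
  exact ⟨φ, c', R', v, q, hφ, hc, hR, fun t ht => tendstoLocallyUniformly_slice_of_spaceTime hconv ht,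
    hcl, hTI, hcut, hq⟩

end Summit.NavierStokesRegularity.NavierStokesRegularity.Theorems
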